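import Literature.Geometry.Lorentzian.Basic
import Mathlib.Analysis.SpecialFunctions.SmoothTransition
import Mathlib.Analysis.InnerProductSpace.Calculus
import Mathlib.Analysis.Calculus.ContDiff.Operations

/-!
# Route ClusterCompleteness — crux `AdiabaticMultiKerrILED`, line `Sketch`: zone cut-off

Helper file for the crux `stmt-FinalStateConjecture-14310`
(`Summit.FinalStateConjecture.FinalStateConjecture.Theses.ClusterCompleteness.AdiabaticMultiKerrILED`).

For `N` centres in inertial motion `cᵢ(t) = pᵢ + t vᵢ` in the lab frame (`t = x 0`, `y = E4.spatial x`)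
which stay `70(Mᵢ + Mⱼ)`-separated at lab times `t ≥ 0`, we construct a smooth cut-off `ζ : ℝ⁴ → [0, 1]`
(`stub_zoneCutoff`) which is locally `0` near every point with `‖y − cᵢ(t)‖ < 17Mᵢ` for some `i`,
locally `1` near every point with `‖y − cᵢ(t)‖ > 34Mᵢ` for all `i`, nonzero only where
`‖y − cᵢ(t)‖ ≥ 17Mᵢ` for all `i`, and whose first and second derivatives are bounded on `{t ≥ 0}`.

Construction: `ζ = ∏ᵢ gᵢ` with the one-hole factor
`gᵢ x = Real.smoothTransition ((‖y − cᵢ(t)‖² / Mᵢ² − 289) / 867)` (`= 0` for `‖y − cᵢ(t)‖ ≤ 17Mᵢ`,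
`= 1` for `‖y − cᵢ(t)‖ ≥ 34Mᵢ`). The derivative bounds avoid any Hessian formula: each factor is
invariant under the spacetime translation by `(1, vᵢ)`, hence so are its first two derivatives
(`fderiv_comp_add_right`), so their values are values on the slice `{t = 0}`, where the factor is locally
constant outside a compact set; for the product, the separation hypothesis makes all but at most one
factor locally `1` near any point of `{t ≥ 0}`. Standard bump-function calculus. [folklore]
-/

noncomputable section

-- the doubled `FinalStateConjecture.FinalStateConjecture` path component trips dupNamespace
set_option linter.dupNamespace false

open scoped ContDiff Topology
open Filter Set Literature.Geometry.Lorentzian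

namespace Summit.FinalStateConjecture.FinalStateConjecture.Cruxes.AdiabaticMultiKerrILED.Sketch

/-! ### Translation invariance and derivative bounds -/

/-- The derivative of a translation-invariant function is translation invariant (chain rule with a
translation, `fderiv_comp_add_right`). [folklore] -/
theorem fderiv_add_of_forall_add_eq {F : Type*} [NormedAddCommGroup F] [NormedSpace ℝ F]
    {g : E4 → F} {a : E4} (hg : ∀ x, g (x + a) = g x) (x : E4) :
    fderiv ℝ g (x + a) = fderiv ℝ g x := by
  have hfun : (fun y => g (y + a)) = g := funext hg
  rw [← fderiv_comp_add_right a, hfun]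

/-- **Derivative bounds by translation invariance.** If a smooth `g : ℝ⁴ → ℝ` is invariant under the
translations by the multiples of a vector `w` with `w 0 = 1`, and on the slice `{x 0 = 0}` every point
either lies in a fixed compact set or has `g` locally equal to `1` nearby, then `dg` and `d²g` are bounded
on all of `ℝ⁴` (both are translation invariant, vanish where `g` is locally constant, and are continuous
on the compact set). [folklore] -/
theorem exists_bound_fderiv_of_forall_add_smul_eq {g : E4 → ℝ} {w : E4} (hw0 : w 0 = 1)
    (hg : ∀ (x : E4) (s : ℝ), g (x + s • w) = g x) (hsm : ContDiff ℝ ∞ g) {K : Set E4}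
    (hK : IsCompact K) (hslice : ∀ x : E4, x 0 = 0 → x ∈ K ∨ g =ᶠ[𝓝 x] fun _ => (1 : ℝ)) :
    ∃ B : ℝ, ∀ x, ‖fderiv ℝ g x‖ ≤ B ∧ ‖fderiv ℝ (fderiv ℝ g) x‖ ≤ B := by
  have hsm1 : ContDiff ℝ ∞ (fderiv ℝ g) := (contDiff_infty_iff_fderiv.1 hsm).2
  have hc1 : Continuous (fderiv ℝ g) := hsm.continuous_fderiv (by simp)
  have hc2 : Continuous (fderiv ℝ (fderiv ℝ g)) := hsm1.continuous_fderiv (by simp)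
  obtain ⟨B₁, hB₁⟩ := hK.exists_bound_of_continuousOn hc1.continuousOn
  -- the codomain is given explicitly: the operator-norm instances on the iterated dual are found by
  -- unification only at default transparency
  obtain ⟨B₂, hB₂⟩ :=
    hK.exists_bound_of_continuousOn (E := E4 →L[ℝ] E4 →L[ℝ] ℝ) hc2.continuousOn
  have ht1 : ∀ (y : E4) (s : ℝ), fderiv ℝ g (y + s • w) = fderiv ℝ g y := fun y s =>
    fderiv_add_of_forall_add_eq (fun z => hg z s) y
  have ht2 : ∀ (y : E4) (s : ℝ), fderiv ℝ (fderiv ℝ g) (y + s • w) = fderiv ℝ (fderiv ℝ g) y :=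
    fun y s => fderiv_add_of_forall_add_eq (fun z => ht1 z s) y
  refine ⟨max 0 (max B₁ B₂), fun x => ?_⟩
  have hx'0 : (x + (-(x 0)) • w) 0 = 0 := by simp [hw0]
  rw [← ht1 x (-(x 0)), ← ht2 x (-(x 0))]
  rcases hslice _ hx'0 with hxK | hone
  · exact ⟨(hB₁ _ hxK).trans (le_max_of_le_right (le_max_left _ _)),
      (hB₂ _ hxK).trans (le_max_of_le_right (le_max_right _ _))⟩
  · have hD : fderiv ℝ g =ᶠ[𝓝 (x + (-(x 0)) • w)] fun _ => 0 :=
      hone.fderiv.trans (by rw [fderiv_fun_const]; exact EventuallyEq.rfl)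
    have e1 : fderiv ℝ g (x + (-(x 0)) • w) = 0 := hD.eq_of_nhds
    have e2 : fderiv ℝ (fderiv ℝ g) (x + (-(x 0)) • w) = 0 := by
      rw [hD.fderiv_eq, fderiv_fun_const]; rfl
    have n2 : ‖fderiv ℝ (fderiv ℝ g) (x + (-(x 0)) • w)‖ = 0 := by
      rw [e2, ContinuousLinearMap.opNorm_zero]
    rw [e1, norm_zero, n2]
    exact ⟨le_max_left _ _, le_max_left _ _⟩

/-! ### The one-hole factor -/

/-- **One-hole factor.** For a centre in inertial motion `c(t) = p + t v` and a mass `M > 0`, the function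
`g x = smoothTransition ((‖y − c(t)‖² / M² − 289) / 867)` (`t = x 0`, `y = E4.spatial x`) is smooth with
values in `[0, 1]`, locally `0` where `‖y − c(t)‖ < 17M`, locally `1` where `‖y − c(t)‖ > 34M`, nonzero
only where `‖y − c(t)‖ ≥ 17M`, and has globally bounded first and second derivatives (translation
invariance along `(1, v)` + compactness of the slice ball `{0} × B̄(p, 34M)`). [folklore] -/
theorem exists_oneHoleFactor {M : ℝ} (hM : 0 < M) (p v : E3) :
    ∃ g : E4 → ℝ, ContDiff ℝ ∞ g ∧ (∀ x, 0 ≤ g x ∧ g x ≤ 1) ∧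
      (∀ x : E4, ‖E4.spatial x - p - (x 0) • v‖ < 17 * M → g =ᶠ[𝓝 x] fun _ ↦ 0) ∧
      (∀ x : E4, 34 * M < ‖E4.spatial x - p - (x 0) • v‖ → g =ᶠ[𝓝 x] fun _ ↦ 1) ∧
      (∀ x : E4, g x ≠ 0 → 17 * M ≤ ‖E4.spatial x - p - (x 0) • v‖) ∧
      ∃ B : ℝ, ∀ x, ‖fderiv ℝ g x‖ ≤ B ∧ ‖fderiv ℝ (fderiv ℝ g) x‖ ≤ B := by
  set d : E4 → E3 := fun x => E4.spatial x - p - (x 0) • v with hd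
  have hcoord : ContDiff ℝ ∞ (fun x : E4 => x 0) :=
    (PiLp.proj 2 (fun _ : Fin 4 => ℝ) (0 : Fin 4) : E4 →L[ℝ] ℝ).contDiff
  have hdc : ContDiff ℝ ∞ d :=
    (E4.spatial.contDiff.sub contDiff_const).sub (hcoord.smul contDiff_const)
  have hcont : Continuous d := hdc.continuous
  set g : E4 → ℝ := fun x => Real.smoothTransition ((‖d x‖ ^ 2 / M ^ 2 - 289) / 867) with hg
  have hM2 : 0 < M ^ 2 := by positivity
  have hzero : ∀ y, ‖d y‖ < 17 * M → g y = 0 := by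
    intro y hy
    apply Real.smoothTransition.zero_of_nonpos
    have h1 : ‖d y‖ ^ 2 < (17 * M) ^ 2 := by gcongr
    have h2 : ‖d y‖ ^ 2 / M ^ 2 ≤ 289 := by rw [div_le_iff₀ hM2]; nlinarith
    exact div_nonpos_of_nonpos_of_nonneg (by linarith) (by norm_num)
  have hone : ∀ y, 34 * M < ‖d y‖ → g y = 1 := by
    intro y hy
    apply Real.smoothTransition.one_of_one_le
    have h1 : (34 * M) ^ 2 < ‖d y‖ ^ 2 := by gcongr
    have h2 : 1156 ≤ ‖d y‖ ^ 2 / M ^ 2 := by rw [le_div_iff₀ hM2]; nlinarith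
    rw [le_div_iff₀ (by norm_num : (0 : ℝ) < 867)]; linarith
  have hsm : ContDiff ℝ ∞ g :=
    Real.smoothTransition.contDiff.comp ((((hdc.norm_sq ℝ).div_const _).sub contDiff_const).div_const _)
  have hloc0 : ∀ x : E4, ‖d x‖ < 17 * M → g =ᶠ[𝓝 x] fun _ ↦ 0 := by
    intro x hx
    have hev : ∀ᶠ y in 𝓝 x, ‖d y‖ < 17 * M :=
      hcont.norm.continuousAt.eventually_lt continuousAt_const hx
    exact hev.mono fun y hy => hzero y hy
  have hloc1 : ∀ x : E4, 34 * M < ‖d x‖ → g =ᶠ[𝓝 x] fun _ ↦ 1 := by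
    intro x hx
    have hev : ∀ᶠ y in 𝓝 x, 34 * M < ‖d y‖ :=
      continuousAt_const.eventually_lt hcont.norm.continuousAt hx
    exact hev.mono fun y hy => hone y hy
  refine ⟨g, hsm, fun x => ⟨Real.smoothTransition.nonneg _, Real.smoothTransition.le_one _⟩, hloc0,
    hloc1, fun x hx => le_of_not_gt fun h => hx (hzero x h), ?_⟩
  -- derivative bounds: translation invariance along `w = (1, v)`
  set w : E4 := E4.ofTimeSpace 1 v with hw
  have hw0 : w 0 = 1 := E4.ofTimeSpace_apply_zero 1 v
  have hdt : ∀ (x : E4) (s : ℝ), d (x + s • w) = d x := by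
    intro x s
    simp only [hd, hw, map_add, map_smul, E4.spatial_ofTimeSpace, PiLp.add_apply, PiLp.smul_apply,
      E4.ofTimeSpace_apply_zero, smul_eq_mul, mul_one, add_smul]
    abel
  have hgt : ∀ (x : E4) (s : ℝ), g (x + s • w) = g x := by
    intro x s
    simp only [hg, hdt]
  refine exists_bound_fderiv_of_forall_add_smul_eq hw0 hgt hsm
    ((isCompact_closedBall p (34 * M)).image (E4.continuous_ofTimeSpace 0)) fun x hx0 => ?_
  by_cases hfar : 34 * M < ‖d x‖
  · exact Or.inr (hloc1 x hfar)
  · refine Or.inl ⟨E4.spatial x, ?_, ?_⟩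
    · rw [Metric.mem_closedBall, dist_eq_norm]
      have : d x = E4.spatial x - p := by simp [hd, hx0]
      rw [← this]
      exact le_of_not_gt hfar
    · have := E4.ofTimeSpace_time_spatial x
      rwa [E4.time_apply, hx0] at this

/-! ### The zone cut-off -/

/-- **Zone cut-off (lab frame, for one configuration).** For `N` moving centres `cᵢ(t) = pᵢ + t vᵢ`
which stay `70(Mᵢ + Mⱼ)`-separated at lab times `t ≥ 0`, there is a smooth `ζ : ℝ⁴ → [0, 1]`, locally `0`
near every point with `‖y − cᵢ(t)‖ < 17Mᵢ` for some `i`, locally `1` near every point with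
`‖y − cᵢ(t)‖ > 34Mᵢ` for all `i`, nonzero only where `‖y − cᵢ(t)‖ ≥ 17Mᵢ` for all `i`, with first and
second derivatives bounded on `{t ≥ 0}` (witness `ζ = ∏ᵢ gᵢ` with the one-hole factors of
`exists_oneHoleFactor`; near a point of `{t ≥ 0}` at most one factor is not locally `1`, by the
separation hypothesis). [folklore] -/
theorem stub_zoneCutoff :
    ∀ (N : ℕ) (M : Fin N → ℝ) (p v : Fin N → E3), (∀ i, 0 < M i) →
      (∀ t : ℝ, 0 ≤ t → ∀ i j, i ≠ j → 70 * (M i + M j) ≤ ‖(p i + t • v i) - (p j + t • v j)‖) →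
      ∃ ζ : E4 → ℝ, ContDiff ℝ ∞ ζ ∧ (∀ x, 0 ≤ ζ x ∧ ζ x ≤ 1) ∧
        (∀ x : E4, (∃ i, ‖E4.spatial x - p i - (x 0) • v i‖ < 17 * M i) → ζ =ᶠ[𝓝 x] fun _ ↦ 0) ∧
        (∀ x : E4, (∀ i, 34 * M i < ‖E4.spatial x - p i - (x 0) • v i‖) → ζ =ᶠ[𝓝 x] fun _ ↦ 1) ∧
        (∀ x : E4, ζ x ≠ 0 → ∀ i, 17 * M i ≤ ‖E4.spatial x - p i - (x 0) • v i‖) ∧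
        ∃ K : ℝ, ∀ x : E4, 0 ≤ x 0 → ‖fderiv ℝ ζ x‖ ≤ K ∧ ‖fderiv ℝ (fderiv ℝ ζ) x‖ ≤ K := by
  intro N M p v hM hsep
  choose g hsm hval h0 h1 hne B hB using fun i => exists_oneHoleFactor (hM i) (p i) (v i)
  -- everything is locally `1` far from all the centres
  have hloc1 : ∀ x : E4, (∀ i, 34 * M i < ‖E4.spatial x - p i - (x 0) • v i‖) →
      (fun y => ∏ i, g i y) =ᶠ[𝓝 x] fun _ ↦ (1 : ℝ) := by
    intro x hx
    have : ∀ᶠ y in 𝓝 x, ∀ i, g i y = 1 := Filter.eventually_all.2 fun i => h1 i x (hx i)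
    filter_upwards [this] with y hy
    exact Finset.prod_eq_one fun i _ => hy i
  refine ⟨fun x => ∏ i, g i x, contDiff_prod fun i _ => hsm i, fun x =>
    ⟨Finset.prod_nonneg fun i _ => (hval i x).1,
      Finset.prod_le_one (fun i _ => (hval i x).1) fun i _ => (hval i x).2⟩, ?_, hloc1, ?_, ?_⟩
  · -- locally zero near a near zone
    rintro x ⟨i, hi⟩
    filter_upwards [h0 i x hi] with y hy
    exact Finset.prod_eq_zero (Finset.mem_univ i) hy
  · -- support
    intro x hx i
    exact hne i x (Finset.prod_ne_zero_iff.1 hx i (Finset.mem_univ i))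
  · -- derivative bounds on `{t ≥ 0}`
    refine ⟨∑ i, max (B i) 0, fun x hx0 => ?_⟩
    have hKnn : 0 ≤ ∑ i, max (B i) 0 := Finset.sum_nonneg fun i _ => le_max_right _ _
    by_cases hfar : ∀ i, 34 * M i < ‖E4.spatial x - p i - (x 0) • v i‖
    · have hD : fderiv ℝ (fun y => ∏ i, g i y) =ᶠ[𝓝 x] fun _ => 0 :=
        (hloc1 x hfar).fderiv.trans (by rw [fderiv_fun_const]; exact EventuallyEq.rfl)
      have e2 : fderiv ℝ (fderiv ℝ fun y => ∏ i, g i y) x = 0 := by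
        rw [hD.fderiv_eq, fderiv_fun_const]; rfl
      have n2 : ‖fderiv ℝ (fderiv ℝ fun y => ∏ i, g i y) x‖ = 0 := by
        rw [e2, ContinuousLinearMap.opNorm_zero]
      rw [hD.eq_of_nhds, norm_zero, n2]
      exact ⟨hKnn, hKnn⟩
    · push Not at hfar
      obtain ⟨i, hi⟩ := hfar
      -- by separation, every other factor is locally `1` near `x`
      have hother : ∀ j, j ≠ i → g j =ᶠ[𝓝 x] fun _ ↦ (1 : ℝ) := by
        intro j hji
        apply h1 j x
        have hs := hsep (x 0) hx0 i j (Ne.symm hji)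
        have hdiff : E4.spatial x - p j - (x 0) • v j - (E4.spatial x - p i - (x 0) • v i) =
            (p i + (x 0) • v i) - (p j + (x 0) • v j) := by abel
        have htri : ‖(p i + (x 0) • v i) - (p j + (x 0) • v j)‖ ≤
            ‖E4.spatial x - p j - (x 0) • v j‖ + ‖E4.spatial x - p i - (x 0) • v i‖ := by
          rw [← hdiff]; exact norm_sub_le _ _
        have hMi := hM i
        have hMj := hM j
        linarith
      have hζ : (fun y => ∏ j, g j y) =ᶠ[𝓝 x] g i := by
        have : ∀ᶠ y in 𝓝 x, ∀ j, j ≠ i → g j y = 1 := by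
          refine Filter.eventually_all.2 fun j => ?_
          by_cases hji : j = i
          · exact Filter.Eventually.of_forall fun y h => absurd hji h
          · exact (hother j hji).mono fun y hy _ => hy
        filter_upwards [this] with y hy
        exact Finset.prod_eq_single i (fun j _ hj => hy j hj) fun h => absurd (Finset.mem_univ i) h
      rw [hζ.fderiv_eq, hζ.fderiv.fderiv_eq]
      have hle : max (B i) 0 ≤ ∑ j, max (B j) 0 :=
        Finset.single_le_sum (f := fun j => max (B j) 0) (fun j _ => le_max_right _ _) (Finset.mem_univ i)
      exact ⟨((hB i x).1.trans (le_max_left _ _)).trans hle,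
        ((hB i x).2.trans (le_max_left _ _)).trans hle⟩

end Summit.FinalStateConjecture.FinalStateConjecture.Cruxes.AdiabaticMultiKerrILED.Sketch

end
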